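import Literature.NumberTheory.EllipticCurves.KummerUnramified
import Literature.NumberTheory.EllipticCurves.OpenImageMazurTwistProofs
import Literature.NumberTheory.EllipticCurves.MultiplicativeTransvectionPrimeToVProofs
import HarnessLib

/-!
# Ramification in division fields from the Galois image: unramified at good places `v ∤ n`,
# tame (index a power of `p`) at multiplicative places `v ∤ p` ([IUTchIV] Prop. 1.8 (vii), (D0))

`Proofs` file (theorems only: no definition, no named fact), topic `NumberTheory/EllipticCurves`.
Pattern of `KummerInertiaSurjectiveProofs` (finite level inside `K̄`, profinite inertia lifting
`GaloisRepresentations.exists_mul_mul_mem_inertia`, Mathlib `Ideal.card_inertia_eq_ramificationIdxIn`).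

For a number field `K`, `Γ_K = Gal(K̄/K)`, a finite Galois subextension `L ⊆ K̄` of `K` with
`G = Gal(L/K)`, a finite place `v` of `K`, a prime `𝔓` of `\bar ℤ_K = absIntegers (𝓞 K) K` over `v`
with inertia group `I_𝔓 ≤ Γ_K`, and `P = 𝔓 ∩ 𝓞 L`:

* `Literature.NumberTheory.EllipticCurves.card_inertia_comap_eq_one_of_inertia_le_fixingSubgroup` —
  GENERIC: if `I_𝔓 ≤ Gal(K̄/L)` then the inertia group `I_P(G)` is trivial (`Nat.card = 1`);
* `…exists_card_inertia_comap_eq_pow_of_pow_mem_fixingSubgroup` — GENERIC: if `σ^p ∈ Gal(K̄/L)` for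
  every `σ ∈ I_𝔓` (`p` prime), then `Nat.card I_P(G) = p^k` for some `k`;
* `…ramificationIdx_eq_one_of_inertia_le_fixingSubgroup`, `…exists_ramificationIdx_eq_pow_of_pow_mem_fixingSubgroup`
  — the same for the ramification index `e(Q ∣ v)` of EVERY prime `Q` of `𝓞 L` over `v`
  (`L/K` Galois: `e` does not depend on `Q`, Mathlib `Ideal.ramificationIdxIn_eq_ramificationIdx`).

ELLIPTIC CURVES (`W/K` elliptic, `L ⊆ K(E[n])`, i.e. `ker ρ̄_{E,n} ≤ Gal(K̄/L)`):

* `WeierstrassCurve.ramificationIdx_divisionField_eq_one_of_hasGoodReductionAt` — **good reduction at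
  `v ∤ n` ⇒ `e(Q ∣ v) = 1` for every prime `Q` of `𝓞 L` over `v`** (Néron–Ogg–Shafarevich, easy half:
  the tree's `galoisRepTorsion_eq_one_of_mem_inertia`, Silverman *AEC* VII.4.1; [IUTchIV] Prop. 1.8
  (vii) first sentence "the action of `G_k` on `E_k[n]` is unramified", and condition (D0) of the proof
  of Thm. 1.10, p. 26);
* `WeierstrassCurve.exists_ramificationIdx_divisionField_eq_pow_of_hasMultiplicativeReductionAt` —
  **multiplicative reduction at `v ∤ p` ⇒ `e(Q ∣ v) = p^k`**, in particular prime to the residue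
  characteristic (TAMELY ramified: [IUTchIV] Prop. 1.8 (vii) second sentence "determines a tamely
  ramified extension of `k` whose ramification index over `k` divides `n`" — here the weaker "power of
  `p`", which is what Prop. 1.3 (i) needs; the tree's unipotence `smul_smul_sub_eq_of_mem_inertia_geomPoints`
  and `galoisRepTorsion_pow_eq_one_of_unipotent`), and
  `WeierstrassCurve.not_dvd_ramificationIdx_divisionField_of_hasMultiplicativeReductionAt` (`q ∤ e` for
  every prime `q ≠ p`, e.g. the residue characteristic).

Consumers (cell abc-iut): the per-place hypotheses "`e(w|v) = 1` at good places, `p_v ∤ e(w|v)` at bad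
places" of the real towers `F_tpd ⊆ F ⊆ K = F(E[l])` in [IUTchIV] Thm. 1.10 Step (ii)/(iii)
(`Literature/IUT/LogVolume/Theorem110StepII.lean`, abc-iut-L5-t15's DifferentConductorTower).  Classical
algebraic number theory; nothing here bears on [IUTchIII] Cor. 3.12.

## References

* [SilvermanAEC2009] J. H. Silverman, *The Arithmetic of Elliptic Curves*, 2nd ed. (2009),
  Prop. VII.4.1, Thm. VII.7.1; *ATAEC* V.4–V.5, Ex. 5.13 (b).
* [NeukirchANT1999] J. Neukirch, *Algebraic Number Theory* (1999), Ch. I §9 (9.6), Ch. II (9.9)–(9.11).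
* [Mochizuki2012] S. Mochizuki, *Inter-universal Teichmüller theory IV*, Prop. 1.8 (vii) p. 19 and
  proof of Thm. 1.10, Steps (ii)–(iii), (D0), pp. 24–26 (consumer locators).
-/

noncomputable section

open scoped Pointwise IntermediateField NumberField

open NumberField IsDedekindDomain IntermediateField Field

universe u

namespace Literature.NumberTheory.EllipticCurves

section Generic

variable {K : Type u} [Field K] [NumberField K]

open Literature.NumberTheory.GaloisRepresentations

set_option maxHeartbeats 800000 in
/-- **Profinite inertia lifting at finite level** (Neukirch *ANT* I (9.6) / II (9.11)): for a finite
Galois `L ⊆ K̄` over `K`, a prime `𝔓` of `\bar ℤ_K` and `P = 𝔓 ∩ 𝓞 L`, every element of the inertia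
group `I_P(Gal(L/K))` is the restriction of some `σ ∈ I_𝔓 ≤ Γ_K` — Step 1 of
`exists_mem_inertia_apply_eq_pow_mul_of_valuation_eq_exp`, verbatim, exported.
[cite: NeukirchANT1999, Ch. I §9 Prop. (9.6) and Ch. II Prop. (9.11)] -/
theorem exists_mem_inertia_restrict_eq (L : IntermediateField K (AlgebraicClosure K))
    [FiniteDimensional K L] [IsGalois K L]
    (𝔓 : Ideal (integralClosure (𝓞 K) (AlgebraicClosure K))) [𝔓.IsPrime]
    (g : L ≃ₐ[K] L)
    (hg : g ∈ (𝔓.comap (ringOfIntegersToIntegralClosure (k := K) (Ω := AlgebraicClosure K) L)).inertia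
      (L ≃ₐ[K] L)) :
    ∃ σ : AlgebraicClosure K ≃ₐ[K] AlgebraicClosure K,
      σ ∈ 𝔓.inertia (AlgebraicClosure K ≃ₐ[K] AlgebraicClosure K) ∧ ∀ x : L, σ (x : AlgebraicClosure K) = (g x : AlgebraicClosure K) := by
  classical
  set Ω := AlgebraicClosure K
  set ι := ringOfIntegersToIntegralClosure (k := K) (Ω := Ω) L with hιdef
  set P : Ideal (𝓞 L) := 𝔓.comap ι with hPdef
  rw [Ideal.inertia, AddSubgroup.mem_inertia] at hg
  -- profinite set-up for `Gal(Ω/K)` acting on `B`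
  letI : TopologicalSpace (integralClosure (𝓞 K) Ω) := ⊥
  haveI : DiscreteTopology (integralClosure (𝓞 K) Ω) := ⟨rfl⟩
  haveI : ContinuousSMul (Ω ≃ₐ[K] Ω) (integralClosure (𝓞 K) Ω) :=
    continuousSMul_iff_stabilizer_isOpen.mpr
      (Literature.NumberTheory.GaloisRepresentations.stabilizer_integralClosure_isOpen (𝓞 K))
  let N : Subgroup (Ω ≃ₐ[K] Ω) := L.fixingSubgroup
  have hN : IsClosed (N : Set (Ω ≃ₐ[K] Ω)) := IntermediateField.fixingSubgroup_isClosed L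
  -- lift `g` to `Ω`
  let g₀ : Ω ≃ₐ[K] Ω := AlgEquiv.liftNormal g Ω
  have hg₀ : ∀ x : L, g₀ (x : Ω) = (g x : Ω) := fun x ↦ AlgEquiv.liftNormal_commutes g Ω x
  -- `g₀` acts as inertia on the `N`-invariants of `B`
  have hg₀inv : ∀ b : integralClosure (𝓞 K) Ω, (∀ m ∈ N, m • b = b) → g₀ • b - b ∈ 𝔓 := by
    intro b hb
    have hbL : (b : Ω) ∈ L := by
      rw [← InfiniteGalois.fixedField_fixingSubgroup L, IntermediateField.mem_fixedField_iff]
      intro f hf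
      have := congrArg Subtype.val (hb f hf)
      rwa [integralClosure.coe_smul] at this
    have hbint : IsIntegral ℤ (⟨(b : Ω), hbL⟩ : L) := by
      rw [← isIntegral_algebraMap_iff (algebraMap L Ω).injective]
      exact isIntegral_trans (R := ℤ) (A := 𝓞 K) (b : Ω) b.2
    set x : 𝓞 L := ⟨⟨(b : Ω), hbL⟩, hbint⟩ with hxdef
    have hbx : b = ι x := Subtype.ext rfl
    have hgx : g • x - x ∈ P := hg x
    rw [hPdef, Ideal.mem_comap, map_sub] at hgx
    rw [hbx]
    convert hgx using 2
    apply Subtype.ext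
    rw [integralClosure.coe_smul, coe_ringOfIntegersToIntegralClosure,
      coe_ringOfIntegersToIntegralClosure]
    exact hg₀ x
  obtain ⟨m₁, hm₁, m₂, hm₂, hσ⟩ :=
    GaloisRepresentations.exists_mul_mul_mem_inertia N hN 𝔓 g₀ hg₀inv
  refine ⟨m₁ * g₀ * m₂, hσ, fun x ↦ ?_⟩
  have hm₂x : m₂ (x : Ω) = x := (IntermediateField.mem_fixingSubgroup_iff _ _).mp hm₂ _ x.2
  have hm₁x : m₁ (g₀ (x : Ω)) = g₀ x := by
    rw [hg₀]
    exact (IntermediateField.mem_fixingSubgroup_iff _ _).mp hm₁ _ (g x).2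
  rw [AlgEquiv.mul_apply, AlgEquiv.mul_apply, hm₂x, hm₁x, hg₀]

/-- **If the absolute inertia group `I_𝔓` fixes `L` pointwise, the inertia group of `P = 𝔓 ∩ 𝓞 L` in
`Gal(L/K)` is trivial** (every element of it lifts to `I_𝔓`, `exists_mem_inertia_restrict_eq`).
[cite: NeukirchANT1999, Ch. I §9 Prop. (9.6)] -/
theorem inertia_comap_eq_bot_of_inertia_le_fixingSubgroup (L : IntermediateField K (AlgebraicClosure K))
    [FiniteDimensional K L] [IsGalois K L]
    (𝔓 : Ideal (integralClosure (𝓞 K) (AlgebraicClosure K))) [𝔓.IsPrime]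
    (hI : 𝔓.inertia (AlgebraicClosure K ≃ₐ[K] AlgebraicClosure K) ≤ L.fixingSubgroup) :
    (𝔓.comap (ringOfIntegersToIntegralClosure (k := K) (Ω := AlgebraicClosure K) L)).inertia
      (L ≃ₐ[K] L) = ⊥ := by
  refine (Subgroup.eq_bot_iff_forall _).mpr fun g hg ↦ ?_
  obtain ⟨σ, hσ, hσg⟩ := exists_mem_inertia_restrict_eq L 𝔓 g hg
  have hfix : ∀ x : L, σ (x : AlgebraicClosure K) = x := fun x ↦
    (IntermediateField.mem_fixingSubgroup_iff _ _).mp (hI hσ) _ x.2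
  refine AlgEquiv.ext fun x ↦ Subtype.ext ?_
  rw [AlgEquiv.one_apply]
  exact (hσg x).symm.trans (hfix x)

/-- **If `σ^p` fixes `L` for every `σ ∈ I_𝔓`, the inertia group of `P = 𝔓 ∩ 𝓞 L` in `Gal(L/K)` is
a `p`-group** (`p` prime): its order is `p^k` for some `k`. [cite: NeukirchANT1999, Ch. I §9 Prop. (9.6)] -/
theorem exists_card_inertia_comap_eq_pow_of_pow_mem_fixingSubgroup
    (L : IntermediateField K (AlgebraicClosure K)) [FiniteDimensional K L] [IsGalois K L]
    (𝔓 : Ideal (integralClosure (𝓞 K) (AlgebraicClosure K))) [𝔓.IsPrime] {p : ℕ} (hp : p.Prime)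
    (hI : ∀ σ ∈ 𝔓.inertia (AlgebraicClosure K ≃ₐ[K] AlgebraicClosure K), σ ^ p ∈ L.fixingSubgroup) :
    ∃ k : ℕ, Nat.card ((𝔓.comap (ringOfIntegersToIntegralClosure (k := K) (Ω := AlgebraicClosure K)
      L)).inertia (L ≃ₐ[K] L)) = p ^ k := by
  haveI : Fact p.Prime := ⟨hp⟩
  set I := (𝔓.comap (ringOfIntegersToIntegralClosure (k := K) (Ω := AlgebraicClosure K)
      L)).inertia (L ≃ₐ[K] L) with hIdef
  have hexp : ∀ g : I, (g : L ≃ₐ[K] L) ^ p = 1 := by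
    intro g
    obtain ⟨σ, hσ, hσg⟩ := exists_mem_inertia_restrict_eq L 𝔓 (g : L ≃ₐ[K] L) g.2
    have hfix : ∀ x : L, (σ ^ p) (x : AlgebraicClosure K) = x := fun x ↦
      (IntermediateField.mem_fixingSubgroup_iff _ _).mp (hI σ hσ) _ x.2
    have hpow : ∀ (m : ℕ) (x : L),
        (σ ^ m) (x : AlgebraicClosure K) = (((g : L ≃ₐ[K] L) ^ m) x : AlgebraicClosure K) := by
      intro m
      induction m with
      | zero => intro x; simp only [pow_zero, AlgEquiv.one_apply]
      | succ m ih =>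
        intro x
        simp only [pow_succ', AlgEquiv.mul_apply]
        rw [← hσg, ih]
    refine AlgEquiv.ext fun x ↦ Subtype.ext ?_
    rw [AlgEquiv.one_apply]
    exact ((hpow p x).symm.trans (hfix x))
  have hPG : IsPGroup p I := fun g ↦ ⟨1, Subtype.ext (by rw [pow_one]; exact hexp g)⟩
  exact IsPGroup.iff_card.mp hPG

/-! ### Ramification indices in `𝓞 L` over `𝓞 K` -/

omit [NumberField K] in
/-- The prime `P = 𝔓 ∩ 𝓞 L` of `𝓞 L` below `𝔓` lies over `v` when `𝔓` does (Neukirch *ANT* I §9: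
`𝔓 ∩ 𝓞 L ∩ 𝓞 K = 𝔓 ∩ 𝓞 K = 𝔭_v`). [cite: NeukirchANT1999, Ch. I §9 (9.1)] -/
theorem comap_ringOfIntegersToIntegralClosure_liesOver (L : IntermediateField K (AlgebraicClosure K))
    (v : HeightOneSpectrum (𝓞 K)) (𝔓 : Ideal (integralClosure (𝓞 K) (AlgebraicClosure K)))
    [𝔓.LiesOver v.asIdeal] :
    (𝔓.comap (ringOfIntegersToIntegralClosure (k := K) (Ω := AlgebraicClosure K) L)).LiesOver v.asIdeal := by
  constructor
  change v.asIdeal = Ideal.comap (algebraMap (𝓞 K) (𝓞 L)) (Ideal.comap _ 𝔓)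
  rw [Ideal.comap_comap, ringOfIntegersToIntegralClosure_comp_algebraMap]
  exact Ideal.LiesOver.over

/-- **The common ramification index over `v` of a finite Galois `L/K` inside `K̄`, read on the inertia
group of `𝔓 ∩ 𝓞 L`**: `e(Q ∣ v) = #I_{𝔓 ∩ 𝓞 L}(Gal(L/K))` for EVERY prime `Q` of `𝓞 L` over `v`
(Mathlib `Ideal.card_inertia_eq_ramificationIdxIn`, `Ideal.ramificationIdxIn_eq_ramificationIdx`).
[cite: NeukirchANT1999, Ch. I §9 (9.9) and Prop. (9.6)] -/
theorem ramificationIdx_eq_card_inertia_comap (L : IntermediateField K (AlgebraicClosure K))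
    [FiniteDimensional K L] [IsGalois K L] (v : HeightOneSpectrum (𝓞 K))
    (𝔓 : Ideal (integralClosure (𝓞 K) (AlgebraicClosure K))) [𝔓.IsPrime] [𝔓.LiesOver v.asIdeal]
    (Q : Ideal (𝓞 L)) [Q.IsPrime] [Q.LiesOver v.asIdeal] :
    Q.ramificationIdx (𝓞 K) =
      Nat.card ((𝔓.comap (ringOfIntegersToIntegralClosure (k := K) (Ω := AlgebraicClosure K)
        L)).inertia (L ≃ₐ[K] L)) := by
  haveI : NumberField L := NumberField.of_module_finite K L
  haveI : Module.Finite (𝓞 K) (𝓞 L) := IsIntegralClosure.finite (𝓞 K) K L (𝓞 L)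
  haveI : IsGaloisGroup (L ≃ₐ[K] L) (𝓞 K) (𝓞 L) :=
    IsGaloisGroup.of_isFractionRing (L ≃ₐ[K] L) (𝓞 K) (𝓞 L) K L
  set P : Ideal (𝓞 L) := 𝔓.comap (ringOfIntegersToIntegralClosure (k := K)
    (Ω := AlgebraicClosure K) L) with hPdef
  haveI hPprime : P.IsPrime := Ideal.comap_isPrime _ 𝔓
  haveI hPover : P.LiesOver v.asIdeal := comap_ringOfIntegersToIntegralClosure_liesOver L v 𝔓
  haveI := v.isPrime
  rw [Ideal.card_inertia_eq_ramificationIdxIn (G := L ≃ₐ[K] L) v.asIdeal P,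
    Ideal.ramificationIdxIn_eq_ramificationIdx v.asIdeal Q (L ≃ₐ[K] L)]

/-- `e(Q ∣ v) = 1` for every prime `Q` of `𝓞 L` over `v`, as soon as the absolute inertia group of
SOME prime `𝔓` of `\bar ℤ_K` over `v` fixes `L`. [cite: NeukirchANT1999, Ch. I §9 Prop. (9.6)] -/
theorem ramificationIdx_eq_one_of_inertia_le_fixingSubgroup (L : IntermediateField K (AlgebraicClosure K))
    [FiniteDimensional K L] [IsGalois K L] (v : HeightOneSpectrum (𝓞 K))
    (𝔓 : Ideal (integralClosure (𝓞 K) (AlgebraicClosure K))) [𝔓.IsPrime] [𝔓.LiesOver v.asIdeal]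
    (hI : 𝔓.inertia (AlgebraicClosure K ≃ₐ[K] AlgebraicClosure K) ≤ L.fixingSubgroup)
    (Q : Ideal (𝓞 L)) [Q.IsPrime] [Q.LiesOver v.asIdeal] :
    Q.ramificationIdx (𝓞 K) = 1 := by
  rw [ramificationIdx_eq_card_inertia_comap L v 𝔓 Q,
    inertia_comap_eq_bot_of_inertia_le_fixingSubgroup L 𝔓 hI, Subgroup.card_bot]

/-- `e(Q ∣ v) = p^k` for every prime `Q` of `𝓞 L` over `v`, as soon as `σ^p` fixes `L` for every
`σ` in the absolute inertia group of some `𝔓` over `v`. [cite: NeukirchANT1999, Ch. I §9 Prop. (9.6)] -/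
theorem exists_ramificationIdx_eq_pow_of_pow_mem_fixingSubgroup
    (L : IntermediateField K (AlgebraicClosure K)) [FiniteDimensional K L] [IsGalois K L]
    (v : HeightOneSpectrum (𝓞 K)) (𝔓 : Ideal (integralClosure (𝓞 K) (AlgebraicClosure K)))
    [𝔓.IsPrime] [𝔓.LiesOver v.asIdeal] {p : ℕ} (hp : p.Prime)
    (hI : ∀ σ ∈ 𝔓.inertia (AlgebraicClosure K ≃ₐ[K] AlgebraicClosure K), σ ^ p ∈ L.fixingSubgroup)
    (Q : Ideal (𝓞 L)) [Q.IsPrime] [Q.LiesOver v.asIdeal] :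
    ∃ k : ℕ, Q.ramificationIdx (𝓞 K) = p ^ k := by
  rw [ramificationIdx_eq_card_inertia_comap L v 𝔓 Q]
  exact exists_card_inertia_comap_eq_pow_of_pow_mem_fixingSubgroup L 𝔓 hp hI

end Generic

end Literature.NumberTheory.EllipticCurves

/-! ### Division fields of an elliptic curve -/

namespace WeierstrassCurve

open Literature.NumberTheory.EllipticCurves Literature.NumberTheory.GaloisRepresentations
  IsDedekindDomain.HeightOneSpectrum

variable {K : Type u} [Field K] [NumberField K] (W : WeierstrassCurve K)

/-- **Division fields are unramified at good places `v ∤ n`.**  Let `E/K` be an elliptic curve over a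
number field, `n ≠ 0`, `L ⊆ K̄` a finite Galois subextension of `K` CONTAINED IN `K(E[n])` (i.e. every
`σ ∈ Γ_K` acting trivially on `E[n]` fixes `L`: `ker ρ̄_{E,n} ≤ Gal(K̄/L)`), and `v` a finite place of good
reduction with `v ∤ n`.  Then `e(Q ∣ v) = 1` for every prime `Q` of `𝓞 L` over `v` (Silverman *AEC*
VII.4.1 via the tree's `galoisRepTorsion_eq_one_of_mem_inertia`; [IUTchIV] Prop. 1.8 (vii), first
sentence, and condition (D0) in the proof of Thm. 1.10). [cite: SilvermanAEC2009, Prop. VII.4.1(a)]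
[cite: Mochizuki2012, IUTchIV Prop 1.8 (vii) p.19] -/
theorem ramificationIdx_divisionField_eq_one_of_hasGoodReductionAt [W.IsElliptic] {n : ℤ}
    (L : IntermediateField K (AlgebraicClosure K)) [FiniteDimensional K L] [IsGalois K L]
    (hL : (W.galoisRepTorsion n).ker ≤ L.fixingSubgroup)
    {v : HeightOneSpectrum (𝓞 K)} (hv : W.HasGoodReductionAt v) (hnv : (n : 𝓞 K) ∉ v.asIdeal)
    (Q : Ideal (𝓞 L)) [Q.IsPrime] [Q.LiesOver v.asIdeal] :
    Q.ramificationIdx (𝓞 K) = 1 := by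
  obtain ⟨𝔓, h𝔓⟩ := HeightOneSpectrum.primesAbove_nonempty v
  refine @ramificationIdx_eq_one_of_inertia_le_fixingSubgroup K _ _ L _ _ v 𝔓 h𝔓.1 h𝔓.2
    (fun τ hτ ↦ hL ?_) Q _ _
  exact (MonoidHom.mem_ker).mpr (W.galoisRepTorsion_eq_one_of_mem_inertia hv hnv h𝔓 hτ)

/-- **Division fields are tamely ramified at multiplicative places `v ∤ p`: `e(Q ∣ v)` is a power of
`p`.**  Let `E/K` be elliptic, `p` prime, `L ⊆ K(E[p])` finite Galois over `K` (`ker ρ̄_{E,p} ≤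
Gal(K̄/L)`), `v ∤ p` a place of multiplicative reduction.  Then `e(Q ∣ v) = p^k` for every prime `Q` of
`𝓞 L` over `v`: every `τ` in an inertia group at `v` acts unipotently on `E[p]` (Tate curve / the
tree's `smul_smul_sub_eq_of_mem_inertia_geomPoints`), so `ρ̄(τ)^p = 1`
(`galoisRepTorsion_pow_eq_one_of_unipotent`) and `τ^p ∈ ker ρ̄`.  ([IUTchIV] Prop. 1.8 (vii), second
sentence, in the weaker form "a power of `p`", hence prime to the residue characteristic.)
[cite: SilvermanATAEC1994, V.4–V.5 and Exercise 5.13 (b)] [cite: Mochizuki2012, IUTchIV Prop 1.8 (vii) p.19] -/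
theorem exists_ramificationIdx_divisionField_eq_pow_of_hasMultiplicativeReductionAt [W.IsElliptic]
    {p : ℕ} (hp : p.Prime) (L : IntermediateField K (AlgebraicClosure K)) [FiniteDimensional K L]
    [IsGalois K L] (hL : (W.galoisRepTorsion (p : ℤ)).ker ≤ L.fixingSubgroup)
    {v : HeightOneSpectrum (𝓞 K)} (hv : W.HasMultiplicativeReductionAt v)
    (hpv : (p : 𝓞 K) ∉ v.asIdeal) (Q : Ideal (𝓞 L)) [Q.IsPrime] [Q.LiesOver v.asIdeal] :
    ∃ k : ℕ, Q.ramificationIdx (𝓞 K) = p ^ k := by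
  obtain ⟨𝔓, h𝔓⟩ := HeightOneSpectrum.primesAbove_nonempty v
  refine @exists_ramificationIdx_eq_pow_of_pow_mem_fixingSubgroup K _ _ L _ _ v 𝔓 h𝔓.1 h𝔓.2 p hp
    (fun τ hτ ↦ hL ?_) Q _ _
  -- read `τ` in the tree's `absoluteGaloisGroup K` (same type, instance-friendly name)
  set τ' : absoluteGaloisGroup K := τ with hτ'def
  have hτ' : τ' ∈ 𝔓.inertia (absoluteGaloisGroup K) := hτ
  have hunip : ∀ P : geomTorsion W (p : ℤ), τ' • (τ' • P - P) = τ' • P - P := fun P ↦ Subtype.ext (by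
    have hP : p ^ 1 • (P : geomPoints W) = 0 := by
      rw [pow_one, ← natCast_zsmul]
      exact (Submodule.mem_torsionBy_iff (p : ℤ) P.1).mp P.2
    simpa only [AddSubgroupClass.coe_sub,
      Literature.NumberTheory.EllipticCurves.AddSubgroup.torsionBy.coe_smul] using
      W.smul_smul_sub_eq_of_mem_inertia_geomPoints hv hp hpv le_rfl h𝔓 hτ' hP)
  have key : W.galoisRepTorsion (p : ℤ) τ' ^ p = 1 := W.galoisRepTorsion_pow_eq_one_of_unipotent hunip
  have hker : τ' ^ p ∈ (W.galoisRepTorsion (p : ℤ)).ker :=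
    (MonoidHom.mem_ker).mpr ((map_pow (W.galoisRepTorsion (p : ℤ)) τ' p).trans key)
  exact hker

/-- Under the same hypotheses, **no prime `q ≠ p` divides `e(Q ∣ v)`** — in particular the residue
characteristic of `v` does not (`v ∤ p`): the division field is TAMELY ramified at `v` (the input of
[IUTchIV] Prop. 1.3 (i) at the bad places in Thm. 1.10 Step (ii)). [cite: Mochizuki2012, IUTchIV Prop 1.8 (vii) p.19] -/
theorem not_dvd_ramificationIdx_divisionField_of_hasMultiplicativeReductionAt [W.IsElliptic]
    {p : ℕ} (hp : p.Prime) (L : IntermediateField K (AlgebraicClosure K)) [FiniteDimensional K L]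
    [IsGalois K L] (hL : (W.galoisRepTorsion (p : ℤ)).ker ≤ L.fixingSubgroup)
    {v : HeightOneSpectrum (𝓞 K)} (hv : W.HasMultiplicativeReductionAt v)
    (hpv : (p : 𝓞 K) ∉ v.asIdeal) (Q : Ideal (𝓞 L)) [Q.IsPrime] [Q.LiesOver v.asIdeal]
    {q : ℕ} (hq : q.Prime) (hqp : q ≠ p) :
    ¬ q ∣ Q.ramificationIdx (𝓞 K) := by
  obtain ⟨k, hk⟩ :=
    W.exists_ramificationIdx_divisionField_eq_pow_of_hasMultiplicativeReductionAt hp L hL hv hpv Q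
  rw [hk]
  intro h
  exact hqp ((Nat.prime_dvd_prime_iff_eq hq hp).mp (hq.dvd_of_dvd_pow h))

end WeierstrassCurve

end
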